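import Literature.Topology.FourManifolds.UnknotTubeMatching
import Literature.Topology.FourManifolds.DehnSurgeryTubularUniqueness
import Literature.Topology.FourManifolds.KirbyMovesIsotopyProofs
import HarnessLib

/-!
# Two equally framed oriented tubes of isotopic knots in `S³` are matched by a diffeotopy of `S³`

Topic `Literature/Topology/FourManifolds` (support file for the named fact
`exists_framedKnot_of_hasHandleDecomposition_oneZeroOne` of `PropertyRTraceClosing.lean`, the
trace bridge T of the SPC4 crux `AcyclicBisectionRigidity`: the `4`-dimensional uniqueness of the
trace of a framed knot needs the `3`-dimensional matching of the attaching tubes in the form of a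
**diffeotopy** of `S³ = ∂B⁴`, which is then slid over a collar of `B⁴`
(`BoundaryData.Collar.slideExtension`, `CollarExtension.lean`); the tree so far had it as a bare
diffeomorphism, `Knot.TubularNbhd.exists_diffeomorph_eq_of_hasFraming`,
`DehnSurgeryTubularUniqueness.lean`).  Everything here is **proved**; no definition and no named
fact is introduced.

* `Knot.TubularNbhd.fibreDeriv_ofTube_eq_knotFibreDeriv` — for two oriented tubular
  neighbourhoods `ν₁`, `ν₂` of the same knot, the fibre derivative of the transition map of the
  `CircleTube`s `CircleTube.ofTube νᵢ` (`UnknotTubeMatching.lean`, `CircleTubeTransition.lean`) is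
  the fibre derivative `knotFibreDeriv ν₁ ν₂` of `LinkTubularUniqueness.lean` (the two transition
  maps agree near the zero section); hence the orientation function `CircleTube.frameSign` is
  `knotFrameSign`, which is positive for oriented tubes (`knotFrameSign_pos`): **no reflection of
  the fibre occurs** (`frameSign_ofTube_pos`).
* `Knot.TubularNbhd.exists_diffeotopy_eq_of_hasFraming` — **two oriented tubular neighbourhoods
  `ν₁`, `ν₂` of the same knot `K` with the same framing integer are matched near the zero section
  by a diffeotopy of `S³`**: there are `D : Diffeotopy (𝓡 3) (𝕊 3)`, all of whose stages are the
  identity off `range ν₂`, and `r > 0` with `D₁ (ν₁ (x, w)) = ν₂ (x, w)` for `‖w‖ < r`.  Proof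
  (Kosinski 1993, III (3.5) sharpened by the framing, Gompf–Stipsicz 1999, §4.5, as in
  `exists_diffeomorph_eq_of_hasFraming` but keeping the isotopies): the straight-line diffeotopy
  `CircleTube.exists_diffeotopy_tubeFrame` with the sign `s = 1` turns `ν₁` into
  `ν₂ ∘ (id × Q)`, `Q(x) = [u(x), J u(x)]`; the rotation field `u` has a degree `d` and a smooth
  angle `β` (`exists_int_angle_of_rotationField`); the fibre-twist diffeotopy by `-β`
  (`CircleTube.exists_diffeotopy_untwist`) leaves `ν₂ ∘ R(d θ)`, the `d`-fold twist of `ν₂`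
  (`exists_twist_int`), of framing `m + d`; the end diffeomorphism fixes `K` and transfers the
  framing `m` of `ν₁` to it (`HasFraming.transfer_diffeomorph`), so `d = 0`
  (`existsUnique_hasFraming_holds`).
* `Knot.TubularNbhd.exists_diffeotopy_eq_of_isIsotopic` — **the same for isotopic knots**: for
  `K`, `K'` ambient isotopic (`Knot.IsIsotopic`) and oriented tubes `ν` of `K`, `ν'` of `K'` with
  the same framing integer, a diffeotopy `D` of `S³` and `r > 0` with `D₁ (ν (x, w)) = ν' (x, w)`
  for `‖w‖ < r` (transport `ν` along the ambient isotopy, `Knot.TubularNbhd.isoTransport`,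
  `HasFraming.isoTransport`, `AmbientIsotopy.toDiffeotopy`, then the previous theorem).

## References

* A. A. Kosinski, *Differential Manifolds*, Academic Press (1993), III (3.5) (uniqueness of
  tubular neighbourhoods by an isotopy of the identity), VI (6.6). [Kosinski1993]
* R. E. Gompf, A. I. Stipsicz, *4-Manifolds and Kirby Calculus*, GSM 20 (1999), §4.5 (framings of
  a knot differ by maps `S¹ → SO(2)`, classified by the degree), §5.3. [GompfStipsicz1999]
* M. W. Hirsch, *Differential Topology*, GTM 33 (1976), Ch. 4 §5 Thm. 5.3, Ch. 8 §1 Thm. 1.3.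
  [HirschDT1976]
-/

noncomputable section

open Set Function Metric Filter
open scoped Manifold ContDiff Topology

namespace Literature.Topology.FourManifolds

namespace Knot.TubularNbhd

/-! ### The two transition maps agree near the zero section -/

section SameKnot

variable {K : Knot} (ν₁ ν₂ : Knot.TubularNbhd ⇑K)

/-- The core of the `CircleTube` of an oriented tubular neighbourhood is the knot. [folklore] -/
theorem ofTube_core_eq (x : Metric.sphere (0 : EuclideanSpace ℝ (Fin 2)) 1) :
    (CircleTube.ofTube ν₁.isSmoothEmbedding_coe).core x = K x := by
  rw [CircleTube.ofTube_core_apply, ν₁.coe_apply_zero]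

/-- The `CircleTube`s of two oriented tubular neighbourhoods of the same knot have the same core.
[folklore] -/
theorem ofTube_core_eq_ofTube_core (x : Metric.sphere (0 : EuclideanSpace ℝ (Fin 2)) 1) :
    (CircleTube.ofTube ν₁.isSmoothEmbedding_coe).core x =
      (CircleTube.ofTube ν₂.isSmoothEmbedding_coe).core x := by
  rw [ofTube_core_eq, ofTube_core_eq]

/-- **The transition map of the `CircleTube`s of `ν₁`, `ν₂` agrees with `knotTransition ν₁ ν₂`
near the zero section** (in the fibre variable at a fixed base point): both are `ν₂⁻¹ ∘ ν₁`, the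
inverses of `ν₂` and of its restriction to the unit tube agreeing on the image of the unit tube.
[folklore] -/
theorem transition_ofTube_eventuallyEq (x : Metric.sphere (0 : EuclideanSpace ℝ (Fin 2)) 1) :
    (fun w : EuclideanSpace ℝ (Fin 2) =>
        (CircleTube.transition (CircleTube.ofTube ν₁.isSmoothEmbedding_coe)
          (CircleTube.ofTube ν₂.isSmoothEmbedding_coe) (x, w)).2) =ᶠ[𝓝 0]
      fun w : EuclideanSpace ℝ (Fin 2) => (knotTransition ν₁ ν₂ (x, w)).2 := by
  set Φ₂ := CircleTube.ofTube ν₂.isSmoothEmbedding_coe with hΦ₂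
  -- the fibre points whose image under `ν₁` lies in the target of `Φ₂` form a neighbourhood of `0`
  have hopen : IsOpen {w : EuclideanSpace ℝ (Fin 2) | ν₁ (x, w) ∈ Φ₂.toHomeo.target} :=
    Φ₂.toHomeo.open_target.preimage (ν₁.continuous.comp (Continuous.prodMk_right x))
  have h0 : ν₁ (x, 0) ∈ Φ₂.toHomeo.target := by
    rw [ν₁.coe_apply_zero, ← ν₂.coe_apply_zero]
    exact CircleTube.apply_mem_ofTube_target ν₂.isSmoothEmbedding_coe x (by simp)
  filter_upwards [hopen.mem_nhds h0] with w hw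
  -- write `ν₁ (x, w) = ν₂ q` with `q` in the unit tube
  have hw' : ν₁ (x, w) ∈ ⇑ν₂ '' ((univ : Set (Metric.sphere (0 : EuclideanSpace ℝ (Fin 2)) 1)) ×ˢ
      ball (0 : EuclideanSpace ℝ (Fin 2)) 1) := by
    rw [← CircleTube.ofTube_target_eq_image ν₂.isSmoothEmbedding_coe]; exact hw
  obtain ⟨q, hq, hqeq⟩ := hw'
  have hq2 : ‖q.2‖ < 1 := mem_ball_zero_iff.1 hq.2
  show (Φ₂.toHomeo.symm (ν₁ (x, w))).2 = (ν₂.toHomeo.symm (ν₁ (x, w))).2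
  rw [← hqeq, ν₂.toHomeo_symm_apply]
  have : Φ₂.toHomeo.symm (ν₂ (q.1, q.2)) = (q.1, q.2) :=
    CircleTube.ofTube_symm_apply ν₂.isSmoothEmbedding_coe q.1 hq2
  rw [Prod.mk.eta] at this
  rw [this]

/-- **The fibre derivative of the `CircleTube` transition is the fibre derivative
`knotFibreDeriv ν₁ ν₂`.** [folklore] -/
theorem fibreDeriv_ofTube_eq_knotFibreDeriv (x : Metric.sphere (0 : EuclideanSpace ℝ (Fin 2)) 1) :
    CircleTube.fibreDeriv (CircleTube.ofTube ν₁.isSmoothEmbedding_coe)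
        (CircleTube.ofTube ν₂.isSmoothEmbedding_coe) x = knotFibreDeriv ν₁ ν₂ x := by
  show fderiv ℝ (fun w : EuclideanSpace ℝ (Fin 2) =>
      (CircleTube.transition (CircleTube.ofTube ν₁.isSmoothEmbedding_coe)
        (CircleTube.ofTube ν₂.isSmoothEmbedding_coe) (x, w)).2) 0 =
    fderiv ℝ (fun w : EuclideanSpace ℝ (Fin 2) => (knotTransition ν₁ ν₂ (x, w)).2) 0
  exact (transition_ofTube_eventuallyEq ν₁ ν₂ x).fderiv_eq

/-- The rotation field of the `CircleTube` transition is `knotFrameVec ν₁ ν₂`. [folklore] -/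
theorem frameVec_ofTube_eq_knotFrameVec (x : Metric.sphere (0 : EuclideanSpace ℝ (Fin 2)) 1) :
    CircleTube.frameVec (CircleTube.ofTube ν₁.isSmoothEmbedding_coe)
        (CircleTube.ofTube ν₂.isSmoothEmbedding_coe) x = knotFrameVec ν₁ ν₂ x := by
  show NormedSpace.normalize (CircleTube.fibreDeriv (CircleTube.ofTube ν₁.isSmoothEmbedding_coe)
      (CircleTube.ofTube ν₂.isSmoothEmbedding_coe) x planeE0) =
    NormedSpace.normalize (knotFibreDeriv ν₁ ν₂ x planeE0)
  rw [fibreDeriv_ofTube_eq_knotFibreDeriv]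

/-- The orientation function of the `CircleTube` transition is `knotFrameSign ν₁ ν₂`. [folklore] -/
theorem frameSign_ofTube_eq_knotFrameSign (x : Metric.sphere (0 : EuclideanSpace ℝ (Fin 2)) 1) :
    CircleTube.frameSign (CircleTube.ofTube ν₁.isSmoothEmbedding_coe)
        (CircleTube.ofTube ν₂.isSmoothEmbedding_coe) x = knotFrameSign ν₁ ν₂ x := by
  show inner ℝ (CircleTube.fibreDeriv (CircleTube.ofTube ν₁.isSmoothEmbedding_coe)
        (CircleTube.ofTube ν₂.isSmoothEmbedding_coe) x planeE1)
      (quarterTurn (CircleTube.frameVec (CircleTube.ofTube ν₁.isSmoothEmbedding_coe)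
        (CircleTube.ofTube ν₂.isSmoothEmbedding_coe) x)) =
    inner ℝ (knotFibreDeriv ν₁ ν₂ x planeE1) (quarterTurn (knotFrameVec ν₁ ν₂ x))
  rw [fibreDeriv_ofTube_eq_knotFibreDeriv, frameVec_ofTube_eq_knotFrameVec]

/-- **No reflection of the fibre between oriented tubes**: the orientation function of the
transition of the `CircleTube`s of two oriented tubular neighbourhoods of the same knot is
positive (`knotFrameSign_pos`: the two `det_pos` determinants differ by the factor `det A(x)`).
[cite: Kosinski1993, III (3.5)] -/
theorem frameSign_ofTube_pos (x : Metric.sphere (0 : EuclideanSpace ℝ (Fin 2)) 1) :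
    0 < CircleTube.frameSign (CircleTube.ofTube ν₁.isSmoothEmbedding_coe)
      (CircleTube.ofTube ν₂.isSmoothEmbedding_coe) x := by
  rw [frameSign_ofTube_eq_knotFrameSign]; exact knotFrameSign_pos ν₁ ν₂ x

/-! ### Same knot, same framing: a diffeotopy matching the tubes -/

/-- **Two oriented tubular neighbourhoods of a knot with the same framing integer are matched
near the zero section by a diffeotopy of `S³` supported in the second tube.**  For `ν₁`, `ν₂`
oriented tubular neighbourhoods of the same knot `K ⊆ S³` with `ν₁.HasFraming m`,
`ν₂.HasFraming m`, there are a diffeotopy `D` of `S³`, all of whose stages are the identity off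
`range ν₂`, and `r > 0` with `D₁ (ν₁ (x, w)) = ν₂ (x, w)` for `‖w‖ < r`.  Kosinski (1993),
III (3.5) (an isotopy of the identity carrying one tubular neighbourhood isometrically onto the
other), the residual fibre isometry being a rotation field (no reflection, `frameSign_ofTube_pos`)
of degree `0` because the framings agree (Gompf–Stipsicz 1999, §4.5), hence removable by a fibre
twist diffeotopic to the identity. [cite: Kosinski1993, III (3.5)] [cite: GompfStipsicz1999, §4.5] -/
theorem exists_diffeotopy_eq_of_hasFraming {m : ℤ} (h₁ : ν₁.HasFraming m) (h₂ : ν₂.HasFraming m) :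
    ∃ (D : Diffeotopy (𝓡 3) (Metric.sphere (0 : EuclideanSpace ℝ (Fin 4)) 1)) (r : ℝ), 0 < r ∧
      (∀ t y, y ∉ range ⇑ν₂ → D.toFun t y = y) ∧
      ∀ (x : Metric.sphere (0 : EuclideanSpace ℝ (Fin 2)) 1) (w : EuclideanSpace ℝ (Fin 2)),
        ‖w‖ < r → D.toFun 1 (ν₁ (x, w)) = ν₂ (x, w) := by
  set Φ₁ := CircleTube.ofTube ν₁.isSmoothEmbedding_coe with hΦ₁
  set Φ₂ := CircleTube.ofTube ν₂.isSmoothEmbedding_coe with hΦ₂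
  have hcore : ∀ θ, Φ₁.core θ = Φ₂.core θ := ofTube_core_eq_ofTube_core ν₁ ν₂
  have hs : (1 : ℝ) ^ 2 = 1 := one_pow 2
  have hsgn : ∀ x, 0 < 1 * CircleTube.frameSign Φ₁ Φ₂ x := fun x => by
    rw [one_mul]; exact frameSign_ofTube_pos ν₁ ν₂ x
  -- Step 1: the straight-line diffeotopy, `ν₁ ↦ ν₂ ∘ (id × Q)`
  obtain ⟨D, r, hr, hDout, hD⟩ := CircleTube.exists_diffeotopy_tubeFrame hcore hs hsgn
  -- Step 2: degree and angle of the rotation field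
  set u : Metric.sphere (0 : EuclideanSpace ℝ (Fin 2)) 1 → Metric.sphere (0 : EuclideanSpace ℝ (Fin 2)) 1 :=
    fun x => ⟨CircleTube.frameVec Φ₁ Φ₂ x, mem_sphere_zero_iff_norm.2 (CircleTube.norm_frameVec hcore x)⟩
    with hu
  have husm : ContMDiff (𝓡 1) (𝓡 1) ∞ u := CircleTube.contMDiff_frameUnit hcore
  obtain ⟨d, β, hβ, hrot⟩ := exists_int_angle_of_rotationField husm
  -- Step 3: untwisting the angle by a fibre twist diffeotopic to the identity
  obtain ⟨R, hRout, hR⟩ := CircleTube.exists_diffeotopy_untwist (Φ₂ := Φ₂) hβ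
  set E := D.trans R with hE
  set r₀ := min r (1 / 4) with hr₀
  have hr₀pos : 0 < r₀ := lt_min hr (by norm_num)
  have hEν : ∀ (θ : ℝ) (w : EuclideanSpace ℝ (Fin 2)), ‖w‖ < r₀ →
      E.toFun 1 (ν₁ (circlePoint θ, w)) = ν₂ (circlePoint θ, rotPlane (d * θ) w) := by
    intro θ w hw
    have hwr : ‖w‖ < r := hw.trans_le (min_le_left _ _)
    have hw4 : ‖w‖ ≤ 1 / 4 := (hw.trans_le (min_le_right _ _)).le
    have hQ : ‖CircleTube.tubeFrame hcore hs (circlePoint θ) w‖ ≤ 1 / 4 := by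
      rw [LinearIsometryEquiv.norm_map]; exact hw4
    have h1 : D.toFun 1 (ν₁ (circlePoint θ, w)) =
        Φ₂.toHomeo (circlePoint θ, CircleTube.tubeFrame hcore hs (circlePoint θ) w) :=
      hD (circlePoint θ) w hwr
    rw [hE, Diffeotopy.trans_toFun, comp_apply, h1, hR _ _ hQ, CircleTube.tubeFrame_apply, one_mul]
    show ν₂ (circlePoint θ, rotPlane (-β (circlePoint θ))
      (w 0 • ((u (circlePoint θ) : Metric.sphere (0 : EuclideanSpace ℝ (Fin 2)) 1) :
          EuclideanSpace ℝ (Fin 2)) +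
        w 1 • quarterTurn ((u (circlePoint θ) : Metric.sphere (0 : EuclideanSpace ℝ (Fin 2)) 1) :
          EuclideanSpace ℝ (Fin 2)))) = _
    rw [hrot θ w]
  -- Step 4: the degree vanishes
  obtain ⟨ν₄, hν₄, hν₄fr⟩ := ν₂.exists_twist_int d
  have hEν₄ : ∀ (x : Metric.sphere (0 : EuclideanSpace ℝ (Fin 2)) 1) (w : EuclideanSpace ℝ (Fin 2)),
      ‖w‖ < r₀ → E.toFun 1 (ν₁ (x, w)) = ν₄ (x, w) := fun x w hw => by
    obtain ⟨θ, rfl⟩ := circlePoint_surjective x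
    rw [hEν θ w hw, hν₄]
  have hEK : ∀ x, E.stage 1 (K x) = K x := fun x => by
    have h0 := hEν₄ x 0 (by simpa using hr₀pos)
    rw [ν₁.coe_apply_zero, ν₄.coe_apply_zero] at h0
    rw [Diffeotopy.coe_stage]
    exact h0
  have h₄ : ν₄.HasFraming m := by
    refine h₁.transfer_diffeomorph (E.stage 1) hEK (half_pos hr₀pos) fun x w hw => ?_
    rw [Diffeotopy.coe_stage]
    exact hEν₄ x w (by rw [hw]; exact half_lt_self hr₀pos)
  have hd : d = 0 := by
    have := (existsUnique_hasFraming_holds ν₄).unique h₄ (hν₄fr m h₂)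
    omega
  subst hd
  -- conclusion
  refine ⟨E, r₀, hr₀pos, fun t y hy => ?_, fun x w hw => ?_⟩
  · have hy' : y ∉ Φ₂.toHomeo.target := fun h =>
      hy (CircleTube.ofTube_target_subset_range ν₂.isSmoothEmbedding_coe h)
    rw [hE, Diffeotopy.trans_toFun, comp_apply, hDout t y hy', hRout t y hy']
  · obtain ⟨θ, rfl⟩ := circlePoint_surjective x
    rw [hEν θ w hw, Int.cast_zero, zero_mul, rotPlane_zero]

end SameKnot

/-! ### Isotopic knots, same framing -/

/-- **Equally framed oriented tubes of isotopic knots are matched near the zero section by a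
diffeotopy of `S³`.**  If `K`, `K'` are ambient isotopic knots (`Knot.IsIsotopic`) and `ν`, `ν'`
are oriented tubular neighbourhoods of `K`, `K'` with the same framing integer, then there are a
diffeotopy `D` of `S³` and `r > 0` with `D₁ (ν (x, w)) = ν' (x, w)` for `‖w‖ < r`: transport `ν`
along the ambient isotopy `F` (`isoTransport`: `F₁ ∘ ν` is an oriented tube of `K'` with the same
framing, `HasFraming.isoTransport`), pass from `F` to a diffeotopy (`AmbientIsotopy.toDiffeotopy`)
and compose with the diffeotopy of `exists_diffeotopy_eq_of_hasFraming`.  This is the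
`3`-dimensional input of the isotopy invariance of `2`-handle attachment in `S³ = ∂B⁴`
(Kosinski 1993, VI (6.6): *"if the attaching spheres are isotopic the resulting manifolds are
diffeomorphic"*). [cite: Kosinski1993, III (3.5) and VI (6.6)] [cite: GompfStipsicz1999, §4.5] -/
theorem exists_diffeotopy_eq_of_isIsotopic {K K' : Knot} (hK : K.IsIsotopic K') {m : ℤ}
    (ν : Knot.TubularNbhd ⇑K) (ν' : Knot.TubularNbhd ⇑K') (h : ν.HasFraming m)
    (h' : ν'.HasFraming m) :
    ∃ (D : Diffeotopy (𝓡 3) (Metric.sphere (0 : EuclideanSpace ℝ (Fin 4)) 1)) (r : ℝ), 0 < r ∧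
      ∀ (x : Metric.sphere (0 : EuclideanSpace ℝ (Fin 2)) 1) (w : EuclideanSpace ℝ (Fin 2)),
        ‖w‖ < r → D.toFun 1 (ν (x, w)) = ν' (x, w) := by
  obtain ⟨F, hF⟩ := hK
  have hFK : ∀ x, F.toFun 1 (K x) = K' x := fun x => congrFun hF x
  set ν₁ := ν.isoTransport F 1 hFK with hν₁
  have h₁ : ν₁.HasFraming m := HasFraming.isoTransport ν F 1 hFK h
  obtain ⟨D, r, hr, -, hD⟩ := exists_diffeotopy_eq_of_hasFraming ν₁ ν' h₁ h'
  refine ⟨F.toDiffeotopy.trans D, r, hr, fun x w hw => ?_⟩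
  rw [Diffeotopy.trans_toFun, comp_apply, AmbientIsotopy.toDiffeotopy_toFun, ← hD x w hw]
  rfl

end Knot.TubularNbhd

end Literature.Topology.FourManifolds

end
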